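import Literature.Probability.Percolation.QuadCrossingPivotalArms
import Literature.Probability.Percolation.AnnulusSubcontinuum
import Literature.Probability.Percolation.ZdOpenPathTrim
import Literature.Probability.Percolation.QuadCrossingRotationInvarianceProofs
import HarnessLib

/-!
# From two continuum arms to the lattice four-arm event of Garban's bound (bond `ℤ²`)

Topic `Literature/Probability/Percolation`; proofs only.  The step "thus, in `ω_j` we have the four
arm event from `∂B_j` to `∂Q₀`" of the proof of Schramm–Smirnov's discrete gluing Theorem 1.1
(*On the scaling limits of planar percolation*, Ann. Probab. 39 (2011), §2), for bond percolation on
`δℤ²`, landing in the CLUSTER-FORM four-arm event `fourArmTwoClusters m n` of `FourArmGarban.lean`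
(two open crossings of the square annulus `A_{m,n} = {m ≤ ‖·‖_∞ ≤ n}` lying in distinct open
clusters of the annulus), the event bounded by `Garban2011_fourArm_multiscale`.

Input (from `Quad.exists_two_arms_of_isCrossing`, `QuadCrossingPivotalArms.lean`): two continua
`C₀, C₂` inside the drawn open edges `openEdgeUnion δ ω`, each reaching from sup-norm `≤ m'δ` to
sup-norm `≥ n'δ` around the origin, which no continuum inside the open edges and inside the region
`T ⊇ {‖·‖_∞ ≤ (n'+2)δ}` joins.  Output (`mem_fourArmTwoClusters_of_two_arms`):
`ω ∈ fourArmTwoClusters (m'+1) (n'-1)`.  Steps: restrict each arm to the closed square annulus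
`m'δ ≤ ‖·‖_∞ ≤ n'δ` (`exists_subcontinuum_between_levels`); shadow it by an open lattice path
through the ends of the open edges it meets, all of sup-norm in `[m'-1, n'+1]`
(`openConnIn_of_isPreconnected_subset_openEdgeUnion`); trim to an exact crossing of
`A_{m'+1,n'-1}` (`exists_openConnIn_sqAnnulus_of_openConnIn`); a junction of the two trimmed
crossings inside the annulus would, drawn in the plane together with the two shadows and the two
open edges through the arms, be a continuum inside the open edges joining `C₀` to `C₂`.

* `supNorm`-free rendering: the sup-norm `max |re z| |im z|` is used inline; `supNorm_meshPoint_le_iff`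
  style facts are the lemmas `mem_box_of_max_le`, `max_le_of_mem_box`, `abs_max_sub_max_le_norm`.
* `mem_fourArmTwoClusters_of_two_arms` — the statement above;
* `Quad.mem_fourArmTwoClusters_of_isCrossing` — combined with the two-arms lemma: a crossing of `Q`
  with `K ∖ B(w, ρ)` inside the open edges of `ω₂` (`‖w‖ ≤ δ`), `ω₂` with no crossing, puts `ω₂` in
  `fourArmTwoClusters (m'+1) (n'-1)` whenever `ρ + δ ≤ m'δ`, `√2 n'δ ≤ R - δ`, the sides
  `∂₀Q, ∂₂Q` are farther than `R` from `w`, and the square `{‖·‖_∞ ≤ (n'+2)δ}` lies in `[Q]`;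
* `openEdgeUnion_relabel_shift_neg`, `relabel_mem_fourArmTwoClusters_of_two_arms`,
  `Quad.relabel_mem_fourArmTwoClusters_of_isCrossing` — the same around an arbitrary ball
  `B(w, ρ)`: the configuration translated by `-nearestSite δ w` lies in the four-arm event (its
  `P_p`-probability being that of the event, `bondPercolation_real_preimage_relabel_iso`).

## References

* O. Schramm, S. Smirnov, Ann. Probab. 39 (2011) 1768–1814, arXiv:1101.5820, §2 (proof of
  Thm. 1.1). [SchrammSmirnov2011]
* J. van den Berg, P. Nolin, Progr. Probab. 77 (2020), §1 (the events `𝒜₄(A_{n₁,n₂})`).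
  [VandenbergNolin2020]
-/

noncomputable section

open Set Metric
open Literature.Probability.LatticeModels Literature.Topology.PlaneTopology

namespace Literature.Probability.Percolation

/-! ### The sup-norm in the plane and the boxes of `ℤ²` -/

/-- Sub-additivity of the sup-norm: `|N z - N z'| ≤ ‖z - z'‖`, `N = max |re| |im|`. [folklore] -/
theorem abs_max_sub_max_le_norm (z z' : ℂ) :
    abs (max |z.re| |z.im| - max |z'.re| |z'.im|) ≤ ‖z - z'‖ := by
  have h1 : |z.re - z'.re| ≤ ‖z - z'‖ := by rw [← Complex.sub_re]; exact Complex.abs_re_le_norm _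
  have h2 : |z.im - z'.im| ≤ ‖z - z'‖ := by rw [← Complex.sub_im]; exact Complex.abs_im_le_norm _
  rw [abs_le]
  constructor
  · have := abs_sub_abs_le_abs_sub z'.re z.re
    have := abs_sub_abs_le_abs_sub z'.im z.im
    rw [abs_sub_comm] at h1 h2
    rcases le_total |z'.re| |z'.im| with h | h
    · rw [max_eq_right h]; linarith [le_max_right |z.re| |z.im|]
    · rw [max_eq_left h]; linarith [le_max_left |z.re| |z.im|]
  · have := abs_sub_abs_le_abs_sub z.re z'.re
    have := abs_sub_abs_le_abs_sub z.im z'.im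
    rcases le_total |z.re| |z.im| with h | h
    · rw [max_eq_right h]; linarith [le_max_right |z'.re| |z'.im|]
    · rw [max_eq_left h]; linarith [le_max_left |z'.re| |z'.im|]

/-- A site lies in the box `B(k)` when the sup-norm of its mesh point is at most `kδ` (`δ > 0`).
[folklore] -/
theorem mem_box_of_max_le {δ : ℝ} (hδ : 0 < δ) {k : ℕ} {u : Site 2}
    (h : max |(meshPoint δ u).re| |(meshPoint δ u).im| ≤ k * δ) : u ∈ box 2 k := by
  rw [mem_box]
  rw [meshPoint_re, meshPoint_im, abs_mul, abs_mul, abs_of_pos hδ, max_le_iff] at h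
  have h0 : |((u 0 : ℤ) : ℝ)| ≤ k := le_of_mul_le_mul_left (by linarith [h.1]) hδ
  have h1 : |((u 1 : ℤ) : ℝ)| ≤ k := le_of_mul_le_mul_left (by linarith [h.2]) hδ
  rw [abs_le] at h0 h1
  intro i
  fin_cases i
  · exact ⟨by exact_mod_cast h0.1, by exact_mod_cast h0.2⟩
  · exact ⟨by exact_mod_cast h1.1, by exact_mod_cast h1.2⟩

/-- Conversely the mesh point of a site of `B(k)` has sup-norm at most `kδ` (`δ ≥ 0`). [folklore] -/
theorem max_le_of_mem_box {δ : ℝ} (hδ : 0 ≤ δ) {k : ℕ} {u : Site 2} (h : u ∈ box 2 k) :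
    max |(meshPoint δ u).re| |(meshPoint δ u).im| ≤ k * δ := by
  rw [mem_box] at h
  have h0 := h 0
  have h1 := h 1
  rw [meshPoint_re, meshPoint_im, abs_mul, abs_mul, abs_of_nonneg hδ, max_le_iff]
  have h0' : |((u 0 : ℤ) : ℝ)| ≤ k := abs_le.2 ⟨by exact_mod_cast h0.1, by exact_mod_cast h0.2⟩
  have h1' : |((u 1 : ℤ) : ℝ)| ≤ k := abs_le.2 ⟨by exact_mod_cast h1.1, by exact_mod_cast h1.2⟩
  constructor <;> nlinarith

/-- A point on the drawn segment of a lattice edge has sup-norm within `δ` of that of the first end.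
[folklore] -/
theorem abs_max_sub_max_meshPoint_le {δ : ℝ} (hδ : 0 < δ) {x y : Site 2}
    (hxy : (zdGraph 2).Adj x y) {z : ℂ} (hz : z ∈ segment ℝ (meshPoint δ x) (meshPoint δ y)) :
    abs (max |z.re| |z.im| - max |(meshPoint δ x).re| |(meshPoint δ x).im|) ≤ δ := by
  refine (abs_max_sub_max_le_norm z (meshPoint δ x)).trans ?_
  rw [← dist_eq_norm, dist_comm]
  exact dist_meshPoint_le_of_mem_segment hδ hxy hz

/-! ### Drawn lattice paths -/

/-- The drawn segment of a lattice pair scales with the mesh: `δ • [x, y] = [δx, δy]`. [folklore] -/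
theorem image_mul_edgeTrace (δ : ℝ) (x y : Site 2) :
    (fun z : ℂ => (δ : ℂ) * z) '' edgeTrace s(x, y) = segment ℝ (meshPoint δ x) (meshPoint δ y) := by
  rw [edgeTrace_mk]
  have h : (fun z : ℂ => (δ : ℂ) * z) = ((LinearMap.mul ℝ ℂ (δ : ℂ)).toAffineMap : ℂ → ℂ) := by
    funext z; rfl
  rw [h, image_segment]
  rfl

/-- The trace of a lattice walk is compact (a finite union of segments). [folklore] -/
theorem isCompact_walkTrace {u v : Site 2} (w : (zdGraph 2).Walk u v) : IsCompact (walkTrace w) := by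
  refine (w.edges.finite_toSet).isCompact_biUnion fun e _ => ?_
  induction e using Sym2.ind with
  | h x y =>
    rw [edgeTrace_mk, segment_eq_image']
    exact isCompact_Icc.image (by fun_prop)

/-- The drawn trace (at mesh `δ`) of a walk with open edges lies inside the drawn open edges.
[folklore] -/
theorem image_mul_walkTrace_subset_openEdgeUnion {δ : ℝ} {ω : BondConfig (Site 2)} {u v : Site 2}
    (w : (zdGraph 2).Walk u v) (hw : ∀ e ∈ w.edges, e ∈ ω) :
    (fun z : ℂ => (δ : ℂ) * z) '' walkTrace w ⊆ openEdgeUnion δ ω := by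
  rintro _ ⟨z, hz, rfl⟩
  obtain ⟨e, he, hze⟩ := mem_walkTrace_iff.1 hz
  have hadj : e ∈ (zdGraph 2).edgeSet := w.edges_subset_edgeSet he
  revert hadj hze he
  induction e using Sym2.ind with
  | h x y =>
    intro he hze hadj
    rw [SimpleGraph.mem_edgeSet] at hadj
    refine mem_openEdgeUnion_iff.2 ⟨x, y, hadj, hw _ he, ?_⟩
    rw [← image_mul_edgeTrace]
    exact mem_image_of_mem _ hze

/-- The mesh point of a vertex of a non-trivial walk lies on its drawn trace. [folklore] -/
theorem meshPoint_mem_image_mul_walkTrace {δ : ℝ} {u v : Site 2} {w : (zdGraph 2).Walk u v}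
    (hw : ¬w.Nil) {x : Site 2} (hx : x ∈ w.support) :
    meshPoint δ x ∈ (fun z : ℂ => (δ : ℂ) * z) '' walkTrace w :=
  ⟨Site.toComplex x, toComplex_mem_walkTrace_of_mem_support hw hx, rfl⟩

/-- Points of the drawn trace of a walk inside `B(k)` have sup-norm at most `(k+1)δ` (`δ > 0`).
[folklore] -/
theorem max_le_of_mem_image_mul_walkTrace {δ : ℝ} (hδ : 0 < δ) {k : ℕ} {u v : Site 2}
    {w : (zdGraph 2).Walk u v} (hw : ∀ x ∈ w.support, x ∈ box 2 k) {z : ℂ}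
    (hz : z ∈ (fun z : ℂ => (δ : ℂ) * z) '' walkTrace w) :
    max |z.re| |z.im| ≤ (k + 1) * δ := by
  obtain ⟨z₀, hz₀, rfl⟩ := hz
  obtain ⟨e, he, hze⟩ := mem_walkTrace_iff.1 hz₀
  have hadj : e ∈ (zdGraph 2).edgeSet := w.edges_subset_edgeSet he
  revert hadj hze he
  induction e using Sym2.ind with
  | h x y =>
    intro he hze hadj
    rw [SimpleGraph.mem_edgeSet] at hadj
    have hx : x ∈ w.support := w.fst_mem_support_of_mem_edges he
    have hzs : (δ : ℂ) * z₀ ∈ segment ℝ (meshPoint δ x) (meshPoint δ y) := by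
      rw [← image_mul_edgeTrace]; exact mem_image_of_mem _ hze
    have h1 := abs_max_sub_max_meshPoint_le hδ hadj hzs
    have h2 := max_le_of_mem_box hδ.le (hw x hx)
    rw [abs_le] at h1
    linarith [h1.2]

/-! ### Two continuum arms give the cluster-form four-arm event -/

/-- **From two continuum arms to `fourArmTwoClusters`.**  Let `δ > 0`, `ω` a lattice configuration,
`2 ≤ m'`, `m' + 3 ≤ n'`, and `C₀, C₂` compact preconnected subsets of `openEdgeUnion δ ω`, each with
a point of sup-norm `≤ m'δ` and a point of sup-norm `≥ n'δ`, such that no compact preconnected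
`L ⊆ T ∩ openEdgeUnion δ ω` meets both, where `T ⊇ {‖·‖_∞ ≤ (n'+2)δ}`.  Then
`ω ∈ fourArmTwoClusters (m'+1) (n'-1)`. [cite: SchrammSmirnov2011, §2 (proof of Thm. 1.1: "the four arm event from ∂B_j to ∂Q₀")] -/
theorem mem_fourArmTwoClusters_of_two_arms {δ : ℝ} (hδ : 0 < δ) {ω : BondConfig (Site 2)}
    (hω : ω ⊆ (zdGraph 2).edgeSet) {m' n' : ℕ} (hm' : 2 ≤ m') (hmn : m' + 3 ≤ n') {T C₀ C₂ : Set ℂ}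
    (hT : {z : ℂ | max |z.re| |z.im| ≤ (n' + 2) * δ} ⊆ T)
    (hC₀c : IsCompact C₀) (hC₀p : IsPreconnected C₀) (hC₀O : C₀ ⊆ openEdgeUnion δ ω)
    (hC₀in : ∃ z ∈ C₀, max |z.re| |z.im| ≤ m' * δ) (hC₀out : ∃ z ∈ C₀, n' * δ ≤ max |z.re| |z.im|)
    (hC₂c : IsCompact C₂) (hC₂p : IsPreconnected C₂) (hC₂O : C₂ ⊆ openEdgeUnion δ ω)
    (hC₂in : ∃ z ∈ C₂, max |z.re| |z.im| ≤ m' * δ) (hC₂out : ∃ z ∈ C₂, n' * δ ≤ max |z.re| |z.im|)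
    (hsep : ∀ L : Set ℂ, IsCompact L → IsPreconnected L → L ⊆ T → L ⊆ openEdgeUnion δ ω →
      (L ∩ C₀).Nonempty → (L ∩ C₂).Nonempty → False) :
    ω ∈ fourArmTwoClusters (m' + 1) (n' - 1) := by
  classical
  set N : ℂ → ℝ := fun z => max |z.re| |z.im| with hN
  have hNc : Continuous N := (continuous_abs.comp Complex.continuous_re).max
    (continuous_abs.comp Complex.continuous_im)
  have hmn' : (m' : ℝ) * δ ≤ n' * δ := mul_le_mul_of_nonneg_right (by exact_mod_cast (by omega : m' ≤ n')) hδ.le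
  -- the big annulus containing all ends of edges through the restricted arms
  set S : Set (Site 2) := sqAnnulus (m' - 1) (n' + 1) with hS
  -- one arm: restrict, shadow, trim
  have arm : ∀ C : Set ℂ, IsCompact C → IsPreconnected C → C ⊆ openEdgeUnion δ ω →
      (∃ z ∈ C, N z ≤ m' * δ) → (∃ z ∈ C, n' * δ ≤ N z) →
      ∃ (p : Site 2 × Site 2) (a : ℂ), p ∈ edgePairs δ ω C ∧ a ∈ C ∧
        a ∈ segment ℝ (meshPoint δ p.1) (meshPoint δ p.2) ∧ p.1 ∈ box 2 (n' + 1) ∧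
        ∃ x' ∈ siteSphere (m' + 1), ∃ y' ∈ siteSphere (n' - 1),
          ω ∈ openConnIn (sqAnnulus (m' + 1) (n' - 1)) x' y' ∧ ω ∈ openConnIn S p.1 x' := by
    intro C hCc hCp hCO hin hout
    obtain ⟨K, hKC, hKc, hKp, hKlev, ⟨a, haK, ha⟩, ⟨b, hbK, hb⟩⟩ :=
      exists_subcontinuum_between_levels hNc hmn' hCc hCp hin hout
    have hKO : K ⊆ openEdgeUnion δ ω := hKC.trans hCO
    -- ends of edges through `K` lie in `S`
    have hends : ∀ q ∈ edgePairs δ ω K, q.1 ∈ S := by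
      rintro q ⟨hadj, -, z, hzs, hzK⟩
      have h1 := abs_max_sub_max_meshPoint_le hδ hadj hzs
      have h2 := hKlev z hzK
      rw [abs_le] at h1
      simp only [hS, sqAnnulus, Finset.mem_coe, mem_annulus]
      constructor
      · refine mem_box_of_max_le hδ ?_
        push_cast
        show max |(meshPoint δ q.1).re| |(meshPoint δ q.1).im| ≤ (n' + 1) * δ
        have : N z ≤ n' * δ := h2.2
        linarith [h1.1]
      · intro hb'
        have h3 := max_le_of_mem_box hδ.le hb'
        have h4 : ((m' - 1 - 1 : ℕ) : ℝ) = (m' : ℝ) - 2 := by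
          rw [Nat.sub_sub, Nat.cast_sub (by omega)]; norm_num
        rw [h4] at h3
        have : (m' : ℝ) * δ ≤ N z := h2.1
        have h5 : N z - max |(meshPoint δ q.1).re| |(meshPoint δ q.1).im| ≤ δ := h1.2
        nlinarith
    obtain ⟨p, hp, hap⟩ := exists_mem_edgePairs_of_mem hKO haK
    obtain ⟨q, hq, hbq⟩ := exists_mem_edgePairs_of_mem hKO hbK
    have hconn := openConnIn_of_isPreconnected_subset_openEdgeUnion hδ hKc hKp hKO hends hp hq
    -- inner end in `B(m'+1)`, outer end off `B(n'-2)`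
    have hp1 : p.1 ∈ box 2 (m' + 1) := by
      refine mem_box_of_max_le hδ ?_
      have h1 := abs_max_sub_max_meshPoint_le hδ hp.1 hap
      rw [abs_le] at h1
      push_cast
      have : N a = m' * δ := ha
      show max |(meshPoint δ p.1).re| |(meshPoint δ p.1).im| ≤ (m' + 1) * δ
      linarith [h1.1]
    have hq1 : q.1 ∉ box 2 (n' - 1 - 1) := by
      intro hb'
      have h3 := max_le_of_mem_box hδ.le hb'
      have h4 : ((n' - 1 - 1 : ℕ) : ℝ) = (n' : ℝ) - 2 := by
        rw [Nat.sub_sub, Nat.cast_sub (by omega)]; norm_num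
      rw [h4] at h3
      have h1 := abs_max_sub_max_meshPoint_le hδ hq.1 hbq
      rw [abs_le] at h1
      have : N b = n' * δ := hb
      have h5 : N b - max |(meshPoint δ q.1).re| |(meshPoint δ q.1).im| ≤ δ := h1.2
      nlinarith
    obtain ⟨x', hx', y', hy', hcross, hpx'⟩ := exists_openConnIn_sqAnnulus_of_openConnIn hω hconn
      (by omega) (by omega) hp1 hq1
    have hpC : p ∈ edgePairs δ ω C := by
      obtain ⟨h1, h2, z, hz, hzK⟩ := hp
      exact ⟨h1, h2, z, hz, hKC hzK⟩
    have hp1' : p.1 ∈ box 2 (n' + 1) := box_mono 2 (by omega) hp1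
    exact ⟨p, a, hpC, hKC haK, hap, hp1', x', hx', y', hy', hcross, hpx'⟩
  obtain ⟨p₀, a₀, hp₀, ha₀C, ha₀s, hp₀b, x₀, hx₀, y₀, hy₀, hcross₀, hpx₀⟩ :=
    arm C₀ hC₀c hC₀p hC₀O hC₀in hC₀out
  obtain ⟨p₂, a₂, hp₂, ha₂C, ha₂s, hp₂b, x₂, hx₂, y₂, hy₂, hcross₂, hpx₂⟩ :=
    arm C₂ hC₂c hC₂p hC₂O hC₂in hC₂out
  refine ⟨x₀, hx₀, x₂, hx₂, y₀, hy₀, y₂, hy₂, hcross₀, hcross₂, fun hjoin => ?_⟩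
  -- a junction inside the annulus joins `C₀` to `C₂` inside the open edges
  have hSsub : sqAnnulus (m' + 1) (n' - 1) ⊆ S := sqAnnulus_mono (by omega) (by omega)
  have hjoinS : ω ∈ openConnIn S x₀ x₂ := by
    obtain ⟨h1, h2, h3⟩ := hjoin
    exact ⟨hSsub h1, hSsub h2, h3.map (SimpleGraph.induceHomOfLE (G := openGraph ω) hSsub).toHom⟩
  have hchain : ω ∈ openConnIn S p₀.1 p₂.1 := by
    refine PlanarDuality.openConnIn_trans hpx₀ (PlanarDuality.openConnIn_trans hjoinS ?_)
    rw [openConnIn_comm]; exact hpx₂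
  obtain ⟨W, hWs, hWe⟩ := exists_walk_of_mem_openConnIn hω hchain
  have hWbox : ∀ x ∈ W.support, x ∈ box 2 (n' + 1) := fun x hx => by
    have := hWs x hx
    simp only [hS, sqAnnulus, Finset.mem_coe, mem_annulus] at this
    exact this.1
  -- the two open edges through the arms, drawn
  set E₀ : Set ℂ := segment ℝ (meshPoint δ p₀.1) (meshPoint δ p₀.2) with hE₀
  set E₂ : Set ℂ := segment ℝ (meshPoint δ p₂.1) (meshPoint δ p₂.2) with hE₂
  have hEO : ∀ p : Site 2 × Site 2, p ∈ edgePairs δ ω C₀ ∨ p ∈ edgePairs δ ω C₂ →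
      segment ℝ (meshPoint δ p.1) (meshPoint δ p.2) ⊆ openEdgeUnion δ ω := by
    rintro p hp z hz
    rcases hp with ⟨h1, h2, -⟩ | ⟨h1, h2, -⟩ <;> exact mem_openEdgeUnion_iff.2 ⟨p.1, p.2, h1, h2, hz⟩
  have hEc : ∀ p : Site 2 × Site 2, IsCompact (segment ℝ (meshPoint δ p.1) (meshPoint δ p.2)) :=
    fun p => by rw [segment_eq_image']; exact isCompact_Icc.image (by fun_prop)
  have hEconv : ∀ p : Site 2 × Site 2, IsPreconnected (segment ℝ (meshPoint δ p.1) (meshPoint δ p.2)) :=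
    fun p => (convex_segment _ _).isPreconnected
  have hEN : ∀ p : Site 2 × Site 2, (zdGraph 2).Adj p.1 p.2 → p.1 ∈ box 2 (n' + 1) →
      ∀ z ∈ segment ℝ (meshPoint δ p.1) (meshPoint δ p.2), N z ≤ (n' + 2) * δ := by
    intro p hadj hpb z hz
    have h1 := abs_max_sub_max_meshPoint_le hδ hadj hz
    have h2 := max_le_of_mem_box hδ.le hpb
    rw [abs_le] at h1
    push_cast at h2
    show max |z.re| |z.im| ≤ (n' + 2) * δ
    linarith [h1.2]
  -- the joining continuum
  have hE₀T : E₀ ⊆ T := fun z hz => hT (hEN p₀ hp₀.1 hp₀b z hz)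
  have hE₂T : E₂ ⊆ T := fun z hz => hT (hEN p₂ hp₂.1 hp₂b z hz)
  have hE₀O : E₀ ⊆ openEdgeUnion δ ω := hEO p₀ (Or.inl hp₀)
  have hE₂O : E₂ ⊆ openEdgeUnion δ ω := hEO p₂ (Or.inr hp₂)
  have hm₀ : meshPoint δ p₀.1 ∈ E₀ := left_mem_segment ℝ _ _
  have hm₂ : meshPoint δ p₂.1 ∈ E₂ := left_mem_segment ℝ _ _
  by_cases hnil : W.Nil
  · -- trivial walk: `p₀.1 = p₂.1`, the two edges alone join the arms
    have heq : p₀.1 = p₂.1 := hnil.eq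
    refine hsep (E₀ ∪ E₂) ((hEc p₀).union (hEc p₂))
      (IsPreconnected.union (meshPoint δ p₀.1) hm₀ (by rw [heq]; exact hm₂) (hEconv p₀) (hEconv p₂))
      (union_subset hE₀T hE₂T) (union_subset hE₀O hE₂O) ⟨a₀, Or.inl ha₀s, ha₀C⟩
      ⟨a₂, Or.inr ha₂s, ha₂C⟩
  · set Dr : Set ℂ := (fun z : ℂ => (δ : ℂ) * z) '' walkTrace W with hDr
    have hDc : IsCompact Dr := (isCompact_walkTrace W).image (continuous_const.mul continuous_id)
    have hDp : IsPreconnected Dr :=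
      (isPreconnected_walkTrace W).image _ (continuous_const.mul continuous_id).continuousOn
    have hDO : Dr ⊆ openEdgeUnion δ ω := image_mul_walkTrace_subset_openEdgeUnion W hWe
    have hDT : Dr ⊆ T := fun z hz => hT (by
      have := max_le_of_mem_image_mul_walkTrace hδ hWbox hz
      push_cast at this
      show max |z.re| |z.im| ≤ (n' + 2) * δ
      linarith)
    have hD₀ : meshPoint δ p₀.1 ∈ Dr := meshPoint_mem_image_mul_walkTrace hnil W.start_mem_support
    have hD₂ : meshPoint δ p₂.1 ∈ Dr := meshPoint_mem_image_mul_walkTrace hnil W.end_mem_support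
    refine hsep (E₀ ∪ Dr ∪ E₂) (((hEc p₀).union hDc).union (hEc p₂)) ?_
      (union_subset (union_subset hE₀T hDT) hE₂T) (union_subset (union_subset hE₀O hDO) hE₂O)
      ⟨a₀, Or.inl (Or.inl ha₀s), ha₀C⟩ ⟨a₂, Or.inr ha₂s, ha₂C⟩
    exact IsPreconnected.union (meshPoint δ p₂.1) (Or.inr hD₂) hm₂
      (IsPreconnected.union (meshPoint δ p₀.1) hm₀ hD₀ (hEconv p₀) hDp) (hEconv p₂)


/-! ### Around an arbitrary lattice point: translation to the origin -/

/-- `toComplex` is odd. [folklore] -/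
theorem toComplex_neg (v : Site 2) : Site.toComplex (-v) = -Site.toComplex v := by
  apply Complex.ext <;> simp [Site.toComplex]

/-- Mesh points of translated sites: `δ(x - v) = δx - δv`. [folklore] -/
theorem meshPoint_add_neg (δ : ℝ) (x v : Site 2) :
    meshPoint δ (x + -v) = meshPoint δ x - meshPoint δ v := by
  simp only [meshPoint, toComplex_add, toComplex_neg]
  ring

/-- **Translation of the drawn open edges**: relabelling a configuration by the lattice
translation `x ↦ x - v` translates its drawn open edges by `-δv`. [folklore] -/
theorem openEdgeUnion_relabel_shift_neg (δ : ℝ) (v : Site 2) (ω : BondConfig (Site 2)) :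
    openEdgeUnion δ (BondConfig.relabel (sym2Equiv (zdShiftIso (-v)).toEquiv) ω) =
      (fun z => z - meshPoint δ v) '' openEdgeUnion δ ω := by
  have h := openEdgeUnion_relabel (zdShiftIso (-v)) (Homeomorph.addRight (-meshPoint δ v)) δ
    (fun x y _ => by
      have h1 : ((Homeomorph.addRight (-meshPoint δ v) : ℂ ≃ₜ ℂ) : ℂ → ℂ) =
          fun z => -meshPoint δ v + z := by
        funext z; simp [add_comm]
      rw [h1, segment_translate_image, zdShiftIso_apply, zdShiftIso_apply, meshPoint_add_neg,
        meshPoint_add_neg]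
      congr 1 <;> ring) ω
  rw [h]
  refine image_congr fun z _ => ?_
  simp [sub_eq_add_neg]

/-- **Two continuum arms around a lattice point `v` give the (translated) four-arm event.**  The
statement of `mem_fourArmTwoClusters_of_two_arms` around the centre `c = δv` (sup-norms of
`z - c`), with conclusion `ω - v ∈ fourArmTwoClusters (m'+1) (n'-1)` for the translated
configuration `ω - v = relabel (x ↦ x - v) ω` — whose `P_p`-probability is that of the event
itself (`bondPercolation_real_preimage_relabel_iso`). [cite: SchrammSmirnov2011, §2 (proof of Thm. 1.1)] -/
theorem relabel_mem_fourArmTwoClusters_of_two_arms {δ : ℝ} (hδ : 0 < δ) (v : Site 2)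
    {ω : BondConfig (Site 2)} (hω : ω ⊆ (zdGraph 2).edgeSet) {m' n' : ℕ} (hm' : 2 ≤ m')
    (hmn : m' + 3 ≤ n') {T C₀ C₂ : Set ℂ}
    (hT : {z : ℂ | max |(z - meshPoint δ v).re| |(z - meshPoint δ v).im| ≤ (n' + 2) * δ} ⊆ T)
    (hC₀c : IsCompact C₀) (hC₀p : IsPreconnected C₀) (hC₀O : C₀ ⊆ openEdgeUnion δ ω)
    (hC₀in : ∃ z ∈ C₀, max |(z - meshPoint δ v).re| |(z - meshPoint δ v).im| ≤ m' * δ)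
    (hC₀out : ∃ z ∈ C₀, n' * δ ≤ max |(z - meshPoint δ v).re| |(z - meshPoint δ v).im|)
    (hC₂c : IsCompact C₂) (hC₂p : IsPreconnected C₂) (hC₂O : C₂ ⊆ openEdgeUnion δ ω)
    (hC₂in : ∃ z ∈ C₂, max |(z - meshPoint δ v).re| |(z - meshPoint δ v).im| ≤ m' * δ)
    (hC₂out : ∃ z ∈ C₂, n' * δ ≤ max |(z - meshPoint δ v).re| |(z - meshPoint δ v).im|)
    (hsep : ∀ L : Set ℂ, IsCompact L → IsPreconnected L → L ⊆ T → L ⊆ openEdgeUnion δ ω →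
      (L ∩ C₀).Nonempty → (L ∩ C₂).Nonempty → False) :
    BondConfig.relabel (sym2Equiv (zdShiftIso (-v)).toEquiv) ω ∈
      fourArmTwoClusters (m' + 1) (n' - 1) := by
  set c := meshPoint δ v with hc
  set τ : ℂ ≃ₜ ℂ := Homeomorph.addRight (-c) with hτ
  have hτa : ∀ z : ℂ, τ z = z - c := fun z => by simp [hτ, sub_eq_add_neg]
  have hτimg : ∀ A : Set ℂ, τ '' A = (fun z => z - c) '' A := fun A => by
    refine image_congr fun z _ => hτa z
  set ω' := BondConfig.relabel (sym2Equiv (zdShiftIso (-v)).toEquiv) ω with hω'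
  have hO' : openEdgeUnion δ ω' = τ '' openEdgeUnion δ ω := by
    rw [hτimg]; exact openEdgeUnion_relabel_shift_neg δ v ω
  have hωe' : ω' ⊆ (zdGraph 2).edgeSet := by
    intro z hz
    rw [hω', BondConfig.relabel_apply] at hz
    obtain ⟨e, he, rfl⟩ := hz
    exact (sym2Equiv_mem_edgeSet_iff _ e).2 (hω he)
  -- transport the arms, the region and the separation
  have himg : ∀ {C : Set ℂ} {z : ℂ}, z ∈ C → τ z ∈ τ '' C := fun hz => mem_image_of_mem _ hz
  refine mem_fourArmTwoClusters_of_two_arms hδ hωe' hm' hmn (T := τ '' T) (C₀ := τ '' C₀)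
    (C₂ := τ '' C₂) ?_ (hC₀c.image τ.continuous) (hC₀p.image _ τ.continuous.continuousOn) ?_ ?_ ?_
    (hC₂c.image τ.continuous) (hC₂p.image _ τ.continuous.continuousOn) ?_ ?_ ?_ ?_
  · intro z hz
    refine ⟨z + c, hT ?_, by rw [hτa]; ring⟩
    simpa only [mem_setOf_eq, add_sub_cancel_right] using hz
  · rw [hO']; exact image_mono hC₀O
  · obtain ⟨z, hz, h⟩ := hC₀in; exact ⟨τ z, himg hz, by rwa [hτa]⟩
  · obtain ⟨z, hz, h⟩ := hC₀out; exact ⟨τ z, himg hz, by rwa [hτa]⟩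
  · rw [hO']; exact image_mono hC₂O
  · obtain ⟨z, hz, h⟩ := hC₂in; exact ⟨τ z, himg hz, by rwa [hτa]⟩
  · obtain ⟨z, hz, h⟩ := hC₂out; exact ⟨τ z, himg hz, by rwa [hτa]⟩
  · intro L hLc hLp hLT hLO hL₀ hL₂
    refine hsep (τ.symm '' L) (hLc.image τ.symm.continuous) (hLp.image _ τ.symm.continuous.continuousOn)
      ?_ ?_ ?_ ?_
    · rintro _ ⟨z, hz, rfl⟩
      obtain ⟨t, ht, htz⟩ := hLT hz
      rw [← htz, Homeomorph.symm_apply_apply]; exact ht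
    · rintro _ ⟨z, hz, rfl⟩
      have := hLO hz
      rw [hO'] at this
      obtain ⟨t, ht, htz⟩ := this
      rw [← htz, Homeomorph.symm_apply_apply]; exact ht
    · obtain ⟨z, hzL, ⟨t, ht, htz⟩⟩ := hL₀
      exact ⟨t, ⟨z, hzL, by rw [← htz, Homeomorph.symm_apply_apply]⟩, ht⟩
    · obtain ⟨z, hzL, ⟨t, ht, htz⟩⟩ := hL₂
      exact ⟨t, ⟨z, hzL, by rw [← htz, Homeomorph.symm_apply_apply]⟩, ht⟩


/-! ### The four-arm event from a destroyed crossing -/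

namespace QuadCrossing.Quad

variable {D : Set ℂ}

/-- The sup-norm is at most the Euclidean norm. [folklore] -/
theorem max_abs_re_im_le_norm (z : ℂ) : max |z.re| |z.im| ≤ ‖z‖ :=
  max_le (Complex.abs_re_le_norm z) (Complex.abs_im_le_norm z)

/-- **"In `ω_j` we have the four arm event from `∂B_j` to `∂Q₀`"** (cluster form).  Let `K` be a
crossing of the quad `Q` with `K ∖ B(w, ρ) ⊆ openEdgeUnion δ ω₂` (e.g. `K` inside the open edges of
a configuration `ω₁` agreeing with the lattice configuration `ω₂` off the edges drawn inside
`B(w, ρ)`), suppose NO crossing of `Q` lies inside `openEdgeUnion δ ω₂`, that `∂₀Q, ∂₂Q` are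
farther than `R ≥ ρ` from `w`, `‖w‖ ≤ δ` (the ball is centred within a mesh of the origin), and let
`2 ≤ m'`, `m' + 3 ≤ n'` with `ρ + δ ≤ m'δ`, `√2 · n'δ ≤ R - δ` and the square `{‖·‖_∞ ≤ (n'+2)δ}`
inside `[Q]`.  Then `ω₂ ∈ fourArmTwoClusters (m'+1) (n'-1)` (`Quad.exists_two_arms_of_isCrossing`
and `mem_fourArmTwoClusters_of_two_arms`). [cite: SchrammSmirnov2011, §2 (proof of Thm. 1.1)] -/
theorem mem_fourArmTwoClusters_of_isCrossing (Q : Quad D) {δ : ℝ} (hδ : 0 < δ)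
    {ω₂ : BondConfig (Site 2)} (hω₂ : ω₂ ⊆ (zdGraph 2).edgeSet) {K : Set ℂ} {w : ℂ} {ρ R : ℝ}
    (hK : Q.IsCrossing K) (hKO : K \ ball w ρ ⊆ openEdgeUnion δ ω₂)
    (hno : ∀ K', Q.IsCrossing K' → ¬K' ⊆ openEdgeUnion δ ω₂) (hρR : ρ ≤ R)
    (hfar : ∀ z ∈ Q.side 0 ∪ Q.side 2, R < dist z w) (hw : ‖w‖ ≤ δ) {m' n' : ℕ} (hm' : 2 ≤ m')
    (hmn : m' + 3 ≤ n') (hρm : ρ + δ ≤ m' * δ) (hnR : Real.sqrt 2 * (n' * δ) ≤ R - δ)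
    (hT : {z : ℂ | max |z.re| |z.im| ≤ (n' + 2) * δ} ⊆ Q.carrier) :
    ω₂ ∈ fourArmTwoClusters (m' + 1) (n' - 1) := by
  obtain ⟨C₀, C₂, hC₀K, hC₂K, hC₀c, hC₀conn, hC₂c, hC₂conn, -, -, ⟨z₀, hz₀, hz₀ρ⟩, ⟨u₀, hu₀, hu₀R⟩,
    ⟨z₂, hz₂, hz₂ρ⟩, ⟨u₂, hu₂, hu₂R⟩, hsep⟩ :=
    Q.exists_two_arms_of_isCrossing hK hKO hno hρR hfar
  have hin : ∀ z : ℂ, dist z w = ρ → max |z.re| |z.im| ≤ m' * δ := fun z hz => by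
    have h1 := max_abs_re_im_le_norm z
    have h2 : ‖z‖ ≤ ‖z - w‖ + ‖w‖ := norm_le_norm_sub_add z w
    rw [← dist_eq_norm, hz] at h2
    linarith
  have hout : ∀ z : ℂ, R < dist z w → (n' : ℝ) * δ ≤ max |z.re| |z.im| := fun z hz => by
    have h1 := Complex.norm_le_sqrt_two_mul_max z
    have h2 : ‖z - w‖ ≤ ‖z‖ + ‖w‖ := norm_sub_le z w
    rw [← dist_eq_norm] at h2
    have h3 : Real.sqrt 2 * (n' * δ) ≤ Real.sqrt 2 * max |z.re| |z.im| := by linarith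
    exact le_of_mul_le_mul_left h3 (Real.sqrt_pos.2 (by norm_num))
  exact mem_fourArmTwoClusters_of_two_arms hδ hω₂ hm' hmn hT hC₀c hC₀conn.isPreconnected
    (hC₀K.trans hKO) ⟨z₀, hz₀, hin z₀ hz₀ρ⟩ ⟨u₀, hu₀, hout u₀ hu₀R⟩ hC₂c hC₂conn.isPreconnected
    (hC₂K.trans hKO) ⟨z₂, hz₂, hin z₂ hz₂ρ⟩ ⟨u₂, hu₂, hout u₂ hu₂R⟩
    fun L hLc hLp hLT hLO hL₀ hL₂ =>
      hsep L hLc ⟨hL₀.mono inter_subset_left, hLp⟩ hLT hLO hL₀ hL₂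


/-- **The four-arm event from a destroyed crossing, around an arbitrary ball.**  As
`mem_fourArmTwoClusters_of_isCrossing`, for a ball `B(w, ρ)` anywhere: with `v = nearestSite δ w`
(so `‖w - δv‖ ≤ δ`) the translated configuration `ω₂ - v` lies in
`fourArmTwoClusters (m'+1) (n'-1)` whenever `ρ + δ ≤ m'δ`, `√2 · n'δ ≤ R - δ`, `∂₀Q, ∂₂Q` are
farther than `R ≥ ρ` from `w` and the square `{‖· - δv‖_∞ ≤ (n'+2)δ}` lies in `[Q]`; its
probability is `P_p(fourArmTwoClusters (m'+1) (n'-1))` by translation invariance.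
[cite: SchrammSmirnov2011, §2 (proof of Thm. 1.1: "the four arm event from ∂B_j to ∂Q₀")] -/
theorem relabel_mem_fourArmTwoClusters_of_isCrossing (Q : Quad D) {δ : ℝ} (hδ : 0 < δ)
    {ω₂ : BondConfig (Site 2)} (hω₂ : ω₂ ⊆ (zdGraph 2).edgeSet) {K : Set ℂ} {w : ℂ} {ρ R : ℝ}
    (hK : Q.IsCrossing K) (hKO : K \ ball w ρ ⊆ openEdgeUnion δ ω₂)
    (hno : ∀ K', Q.IsCrossing K' → ¬K' ⊆ openEdgeUnion δ ω₂) (hρR : ρ ≤ R)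
    (hfar : ∀ z ∈ Q.side 0 ∪ Q.side 2, R < dist z w) {m' n' : ℕ} (hm' : 2 ≤ m')
    (hmn : m' + 3 ≤ n') (hρm : ρ + δ ≤ m' * δ) (hnR : Real.sqrt 2 * (n' * δ) ≤ R - δ)
    (hT : {z : ℂ | max |(z - meshPoint δ (nearestSite δ w)).re|
      |(z - meshPoint δ (nearestSite δ w)).im| ≤ (n' + 2) * δ} ⊆ Q.carrier) :
    BondConfig.relabel (sym2Equiv (zdShiftIso (-nearestSite δ w)).toEquiv) ω₂ ∈
      fourArmTwoClusters (m' + 1) (n' - 1) := by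
  set v := nearestSite δ w with hv
  set c := meshPoint δ v with hc
  have hwc : ‖w - c‖ ≤ δ := by rw [← dist_eq_norm, dist_comm]; exact dist_meshPoint_nearestSite_le hδ w
  obtain ⟨C₀, C₂, hC₀K, hC₂K, hC₀c, hC₀conn, hC₂c, hC₂conn, -, -, ⟨z₀, hz₀, hz₀ρ⟩, ⟨u₀, hu₀, hu₀R⟩,
    ⟨z₂, hz₂, hz₂ρ⟩, ⟨u₂, hu₂, hu₂R⟩, hsep⟩ :=
    Q.exists_two_arms_of_isCrossing hK hKO hno hρR hfar
  have hin : ∀ z : ℂ, dist z w = ρ → max |(z - c).re| |(z - c).im| ≤ m' * δ := fun z hz => by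
    have h1 := max_abs_re_im_le_norm (z - c)
    have h2 : ‖z - c‖ ≤ ‖z - w‖ + ‖w - c‖ := norm_sub_le_norm_sub_add_norm_sub z w c
    rw [← dist_eq_norm z w, hz] at h2
    linarith
  have hout : ∀ z : ℂ, R < dist z w → (n' : ℝ) * δ ≤ max |(z - c).re| |(z - c).im| := fun z hz => by
    have h1 := Complex.norm_le_sqrt_two_mul_max (z - c)
    have h2 : ‖z - w‖ ≤ ‖z - c‖ + ‖w - c‖ := by
      have := norm_sub_le_norm_sub_add_norm_sub z c w
      rwa [norm_sub_rev c w] at this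
    rw [← dist_eq_norm z w] at h2
    have h3 : Real.sqrt 2 * (n' * δ) ≤ Real.sqrt 2 * max |(z - c).re| |(z - c).im| := by linarith
    exact le_of_mul_le_mul_left h3 (Real.sqrt_pos.2 (by norm_num))
  exact relabel_mem_fourArmTwoClusters_of_two_arms hδ v hω₂ hm' hmn hT hC₀c hC₀conn.isPreconnected
    (hC₀K.trans hKO) ⟨z₀, hz₀, hin z₀ hz₀ρ⟩ ⟨u₀, hu₀, hout u₀ hu₀R⟩ hC₂c hC₂conn.isPreconnected
    (hC₂K.trans hKO) ⟨z₂, hz₂, hin z₂ hz₂ρ⟩ ⟨u₂, hu₂, hout u₂ hu₂R⟩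
    fun L hLc hLp hLT hLO hL₀ hL₂ =>
      hsep L hLc ⟨hL₀.mono inter_subset_left, hLp⟩ hLT hLO hL₀ hL₂

end QuadCrossing.Quad

end Literature.Probability.Percolation

end
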